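import Literature.MathematicalPhysics.QuantumFieldTheory.Balaban1983to89.B13Sect1Arith

/-!
# `Balaban1983to89.B13Lemma1Assembly` — T. Bałaban, *Renormalization group approach to lattice gauge field theories.
II. Cluster expansions*, Commun. Math. Phys. **116** (1988) 1–22, doi:10.1007/bf01239022 [Balaban1988RG2Cluster]:
**Lemma 1 (1.33)–(1.36) p. 9 ASSEMBLED AS PRINTED** over the record carrier `B13.StepData` — the resummation of
pp. 7–9 («Now we consider the sum of all terms (1.23) having the same localization domain Y», p. 7; «Now we sum all the
terms having the same localization domain Y», p. 9) carried from the located printed inputs to the statement of record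
`B13.Lemma1Printed S c` (`…Balaban1983to89.B13`, unit r2/b13: analyticity of `V′_k(Y, ·)` on the space (1.34) ∧ the
bound (1.36)) — the first theorems of the tree CONCLUDING `B13.Lemma1Printed` (so far consumed only, by
`B13.lemma2_of_lemma1` and the DAG leaf `DagBinding.Leaves.b13`; `B13Resum220.bound136_iff_rhs136` is the definitional
unfolding of `B13.Bound136`)

statement-level skeleton of published theorems with citation tags; proofs where landed; nothing here is a claim about
the Yang–Mills mass gap

PDF held: `paper:balaban1988-cmp116-rg-ii-cluster` (journal page = PDF page + 0); pp. 2–11 re-read this session from the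
text layer (`lit read paper:balaban1988-cmp116-rg-ii-cluster --pages 1-11`); the displays (1.24)–(1.29), (1.36) are
quoted verbatim (render-checked) in the sibling `…Balaban1983to89.B13Sect1Arith` (unit pv20-g2), whose kernel
certificates `bound_125` ((1.24) ⇒ (1.25)), `bound_127` ((1.27)), `jsum_le` («the sum over j is bounded by 2(6L)⁴»),
`gather_129` ((1.29) = the nested □₀/Y₀/j/□′/X resummation over abstract finite index sets) and `shape_136` (R9 ⇒ the
rate of (1.36)) this module uses BY NAME; nothing there or in `…B13` is modified (NEW LEAF importing `B13Sect1Arith`).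

CITATION HEADER / WHAT IS REPRODUCED (cell `pub-ymgap`, Track A node N10 = [B13], prover seat `pub-ymgap-dag-p2`, T1 of
the payload `HOME/OPS-REQUESTS.md` l.309; YM-PLAN row N10; FIRST3-READINESS §2 N10 «FIRST MISSING LEMMA: Lemma 1
(p. 9)»).  p. 9 [PDF 9], verbatim: *"The results obtained for the expression in the curly bracket {⋯} can be summarized
as follows.  Lemma 1. The second expression in the fluctuation field action in (I.2.13) is represented as the sum
E_k(U_k(exp iB′V^{(k)})) − E_k(U_k(V^{(k)})) = Σ_{Y∈𝐃_k} V′_k(Y, U_{k+1}, B). (1.33)  For each term in the sum there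
exists a function V′_k(Y, 𝐔, 𝐉, B), defined and analytic on the space U^c_{k+1}(Y, (1+β)α₀, (1+β)α₁, α₀) ×
{B : |B| < ε₁g_k⁻¹ on Y}, (1.34) … There exist absolute constants C₁, C₂, q, for which
|V′_k(Y, 𝐔, 𝐉, B)| ≤ E₀ε₁C₁M^q exp C₂κ₁ exp(−(1 − 2δ)κd_k(Y)). (1.36)"*  The printed proof (pp. 2–9) treats the
terms of the curly bracket by type — p. 2: *"Analyzing the terms (I.3.7), (I.3.21) or (I.3.34) …"*; p. 8: *"These
considerations and bounds were done on the example of the last term on the right-hand side of (I.3.34), but almost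
all of them are quite general … The summation over all possible choices of □₀, Y₀, j, X yields an expression satisfying
(1.29)"*; p. 9: *"The expression in (I.3.21) … is expanded and analyzed in almost the same way as the last term in
(I.3.34)"*; and for (I.3.7): p. 9 *"These estimates yield again a bound of the form (1.29) for the considered sum,
with the last exponential replaced by exp(−(1 − 2δ)κd_k(Y)). We assume that (1/16)κ₁ ≥ (1 − 2δ)κ, hence we can bound
both sums by the above exponential."*  THIS MODULE types that assembly, hypotheses = located printed inputs only:
* `bound136_of_129` — p. 9: the two Y-sums (rate (1/16)κ₁ from (1.29), rate (1 − 2δ)κ for the (I.3.7)-type terms),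
  restriction R9 «(1/16)κ₁ ≥ (1 − 2δ)κ» and the CHOICE of the absolute constants of (1.36) dominating the two
  prefactors ⇒ `B13.Bound136 S c S.Vp`; `lemma1Printed_of_129` — + «all the terms are defined and analytic on it»
  (p. 9) ⇒ `B13.Lemma1Printed S c`.
* `bound129_of_levels` — **(1.24)×(1.25) per term + (1.26), «(6L)⁴L^jη», «2(6L)⁴», (1.27), (1.28) ⇒ (1.29)** for the
  Y-sum of the terms (1.23) as FUNCTIONS on the space (1.34) (the scalar certificate `B13Sect1Arith.gather_129` lifted
  through `‖Σ‖ ≤ Σ‖·‖`); `sumY0_127` — the Y₀-sum of p. 8 as the printed powerset sum, ≤ e by `bound_127`.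
* `lemma1Printed_of_sect1` — END TO END: V′_k(Y) := (the (I.3.34)/(I.3.21)-type sum of the terms (1.23) over □₀ ⊂ Y,
  Y₀ ↔ subsets of the cubes of □₀∖□̃⁴, j ≤ k, □′ ⊂ □̃², X ∈ 𝐃_j ∋ □′) + (the (I.3.7)-type Y-sum); per-term
  analyticity (p. 7) and bound (1.24) on (1.34); the geometric input of (1.25); the counts «8·12³» (1.27), (1.26),
  «(6L)⁴L^jη», (1.28); «for κ₁ sufficiently large» as the explicit threshold of `bound_127`; L ≥ 2 (for `jsum_le`;
  [I] p. 251: L odd > 11); the p. 9 bound for the (I.3.7)-type sum; R9; the constants ⇒ `B13.Lemma1Printed S c`.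
WHAT ENTERS ONLY AS HYPOTHESES (by assertion or by reference in print; cell `pub-balaban` GAPS.md G-B13-01…05, C-B13-01):
the per-term bound (1.24) itself (its inputs are (I.3.54) of [I], Prop. 4 / (98) of [15] = [Balaban1985Variational],
(1.7) = (3.108) of [13] = [Balaban1985BackgroundPropagators] — the places where the node's in-edges b9/b11 enter the
printed proof; they are therefore NOT separate hypotheses of this module, which would be idle decoration), the
analyticity of the individual terms (p. 7, from Sect. I.3), (1.26) (kernel elsewhere for the cube geometry:
`…B12TreeDecay`), the cube counts, the (I.3.7)-type bound of p. 9 (its own chain (1.30)–(1.32) is certified as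
scalars in `B13Sect1Arith.bound_132` / `factor_Ljη` / `cubesum_p9`), the identification of the gathered prefactor
with «E₀ε₁O(M^q) exp O(1)κ₁» (presupposes [I]'s choice of the α's as powers of M; NOT asserted — it is the constants
hypothesis `hC`), and the two closure properties of the READER-OWNED predicate `S.Analytic` (sums of analytic functions
are analytic; [folklore]) that print uses silently between «all the terms are analytic» and «V′_k is analytic».
NO hypothesis restates (1.36): the conclusion's rate (1 − 2δ)κ, constants C₁, C₂, q and function V′_k appear in no
bound hypothesis.  MODELLING CONVENTIONS (as `B13Sect1Arith`, cell DIVERGENCE D-pv20.5): the families {□₀}, {□′}, {X}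
are abstract finite index sets carried with the printed level bounds; the dependence of {□′}, {X} on □₀ is suppressed
(the printed counts are uniform in □₀); Y₀ IS the powerset of the cubes of □₀∖□̃⁴ (p. 8 «simply a sum over subsets»);
`K` abbreviates the (1.24) prefactor 8B₀C₁e^{16κ₁}α₂⁻¹ε₁E₀(α₁/α₃)⁵ with g_k|B| already replaced by ε₁ (p. 8: *"Another
possibility is to use the expression g_k|B| instead of ε₁"*).  The theorems specialize verbatim to the torus carrier
`B13Lemma3Torus.TwoTorusStep 4 L N′` (`W.toStepData`), whose `Vp`, `sp1`, `Analytic` are abstract fields as well.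
HONEST FRAMING: a count-neutral Track-A side landing (YM-PLAN §1); NOT a discharge of node N10 (Lemmas 2–3 and the
NODE 00 pin of the B13 group are separate); one finite T⁴ programme at fixed ε; nothing continuum / OS / mass-gap / Clay.
-/

noncomputable section

namespace Literature.MathematicalPhysics.QuantumFieldTheory.Balaban1983to89.B13Lemma1Assembly

open Literature.MathematicalPhysics.QuantumFieldTheory.Balaban1983to89

/-! ## §0. Finite sums of analytic functions (the silent step of p. 9) -/

/-- Closure of an abstract analyticity predicate under finite sums: if `An` is closed under `+` and holds for `0` on the
set `s`, it holds for every `Finset` sum of functions analytic on `s` — the step print takes silently between *"all the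
terms are defined and analytic on it"* (p. 9) and *"V′_k(Y, 𝐔, 𝐉, B), defined and analytic on the space (1.34)"*.
Private kernel plumbing. [folklore] -/
private theorem analytic_finset_sum {Φ : Type*} (An : (Φ → ℂ) → Set Φ → Prop) (s : Set Φ)
    (hAdd : ∀ f g, An f s → An g s → An (f + g) s) (hZero : An 0 s) {ι : Type*} (I : Finset ι)
    (f : ι → Φ → ℂ) (h : ∀ i ∈ I, An (f i) s) : An (∑ i ∈ I, f i) s :=
  Finset.sum_induction f (fun g => An g s) (fun a b ha hb => hAdd a b ha hb) hZero h

/-! ## §1. p. 9: the two sums, R9 and the constants ⇒ (1.36), and Lemma 1 -/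

/-- **p. 9 ⇒ (1.36).**  p. 9 [PDF 9], verbatim: *"These estimates yield again a bound of the form (1.29) for the
considered sum, with the last exponential replaced by exp(−(1 − 2δ)κd_k(Y)). We assume that (1/16)κ₁ ≥ (1 − 2δ)κ,
hence we can bound both sums by the above exponential. … There exist absolute constants C₁, C₂, q, for which
|V′_k(Y, 𝐔, 𝐉, B)| ≤ E₀ε₁C₁M^q exp C₂κ₁ exp(−(1 − 2δ)κd_k(Y)). (1.36)"*  TYPED: V′_k(Y) = W₁(Y) + W₂(Y) with W₁ = the
Y-sum of the (I.3.34)/(I.3.21)-type terms, bounded on the space (1.34) in the form (1.29) `P₁ exp(−(1/16)κ₁d_k(Y))`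
(p. 8), and W₂ = the Y-sum of the (I.3.7)-type terms, bounded in the form `P₂ exp(−(1 − 2δ)κd_k(Y))` (p. 9); under R9
(`B13Sect1Arith.rate_R9`/`shape_136`) and a choice of the constants of record with `P₁ + P₂ ≤ E₀ε₁C₁M^q e^{C₂κ₁}`,
`V′_k` satisfies (1.36) = `B13.Bound136 S c S.Vp`.  Uses d_k(Y) ≥ 0 (`Setup.LocDomainSys.dj_nonneg`).
[cite: Balaban1988RG2Cluster, Lemma 1 (1.36) p.9] -/
theorem bound136_of_129 (S : B13.StepData) (c : B13.Consts) (W₁ W₂ : S.Dk.Dom → S.Φ → ℂ) {P₁ P₂ : ℝ}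
    (hP₁ : 0 ≤ P₁) (h133 : ∀ Y, S.Vp Y = W₁ Y + W₂ Y)
    (h129 : ∀ Y φ, φ ∈ S.sp1 Y → ‖W₁ Y φ‖ ≤ P₁ * Real.exp (-(1 / 16) * c.κ₁ * S.Dk.dj Y))
    (h129' : ∀ Y φ, φ ∈ S.sp1 Y → ‖W₂ Y φ‖ ≤ P₂ * Real.exp (-(1 - 2 * c.δ) * c.κ * S.Dk.dj Y))
    (hR9 : (1 - 2 * c.δ) * c.κ ≤ (1 / 16) * c.κ₁)
    (hC : P₁ + P₂ ≤ c.E₀ * c.ε₁ * c.C₁ * c.M ^ c.q * Real.exp (c.C₂ * c.κ₁)) :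
    B13.Bound136 S c S.Vp := by
  intro Y φ hφ
  have hd : 0 ≤ S.Dk.dj Y := S.Dk.dj_nonneg Y
  have h1 : ‖W₁ Y φ‖ ≤ P₁ * Real.exp (-(1 - 2 * c.δ) * c.κ * S.Dk.dj Y) :=
    B13Sect1Arith.shape_136 hP₁ hd hR9 (h129 Y φ hφ)
  have h2 := h129' Y φ hφ
  have hE : 0 ≤ Real.exp (-(1 - 2 * c.δ) * c.κ * S.Dk.dj Y) := (Real.exp_pos _).le
  have e : Real.exp (-(1 - 2 * c.δ) * c.κ * S.Dk.dj Y) = Real.exp (-((1 - 2 * c.δ) * c.κ * S.Dk.dj Y)) := by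
    rw [neg_mul, neg_mul]
  rw [h133 Y, ← e]
  calc ‖(W₁ Y + W₂ Y) φ‖ = ‖W₁ Y φ + W₂ Y φ‖ := rfl
    _ ≤ ‖W₁ Y φ‖ + ‖W₂ Y φ‖ := norm_add_le _ _
    _ ≤ P₁ * Real.exp (-(1 - 2 * c.δ) * c.κ * S.Dk.dj Y) + P₂ * Real.exp (-(1 - 2 * c.δ) * c.κ * S.Dk.dj Y) :=
        add_le_add h1 h2
    _ = (P₁ + P₂) * Real.exp (-(1 - 2 * c.δ) * c.κ * S.Dk.dj Y) := by ring
    _ ≤ c.E₀ * c.ε₁ * c.C₁ * c.M ^ c.q * Real.exp (c.C₂ * c.κ₁) * Real.exp (-(1 - 2 * c.δ) * c.κ * S.Dk.dj Y) :=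
        mul_le_mul_of_nonneg_right hC hE

/-- **Lemma 1 p. 9 from the p. 9 summary.**  p. 9 [PDF 9], verbatim: *"Now we sum all the terms having the same
localization domain Y. At first we notice that each term is defined and analytic on the corresponding space (I.3.16)
restricted to the domain Y. All these spaces contain the subspace U^c_{k+1}(Y, (1+β)α₀, (1+β)α₁, α₀), and all the terms
are defined and analytic on it."* — with the two Y-sums W₁, W₂ analytic on (1.34) (`S.sp1 Y`), the reader-owned
predicate `S.Analytic` closed under `+` ([folklore]), and the inputs of `bound136_of_129`: `B13.Lemma1Printed S c`
(analyticity on (1.34) ∧ (1.36); (1.33)/(1.35) are carried by the carrier, `…B13` Part C).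
[cite: Balaban1988RG2Cluster, Lemma 1 p.9] -/
theorem lemma1Printed_of_129 (S : B13.StepData) (c : B13.Consts) (W₁ W₂ : S.Dk.Dom → S.Φ → ℂ) {P₁ P₂ : ℝ}
    (hP₁ : 0 ≤ P₁) (h133 : ∀ Y, S.Vp Y = W₁ Y + W₂ Y)
    (hAdd : ∀ (s : Set S.Φ) (f g : S.Φ → ℂ), S.Analytic f s → S.Analytic g s → S.Analytic (f + g) s)
    (hAn₁ : ∀ Y, S.Analytic (W₁ Y) (S.sp1 Y)) (hAn₂ : ∀ Y, S.Analytic (W₂ Y) (S.sp1 Y))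
    (h129 : ∀ Y φ, φ ∈ S.sp1 Y → ‖W₁ Y φ‖ ≤ P₁ * Real.exp (-(1 / 16) * c.κ₁ * S.Dk.dj Y))
    (h129' : ∀ Y φ, φ ∈ S.sp1 Y → ‖W₂ Y φ‖ ≤ P₂ * Real.exp (-(1 - 2 * c.δ) * c.κ * S.Dk.dj Y))
    (hR9 : (1 - 2 * c.δ) * c.κ ≤ (1 / 16) * c.κ₁)
    (hC : P₁ + P₂ ≤ c.E₀ * c.ε₁ * c.C₁ * c.M ^ c.q * Real.exp (c.C₂ * c.κ₁)) :
    B13.Lemma1Printed S c := by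
  refine ⟨fun Y => ?_, bound136_of_129 S c W₁ W₂ hP₁ h133 h129 h129' hR9 hC⟩
  rw [h133 Y]
  exact hAdd _ _ _ (hAn₁ Y) (hAn₂ Y)

/-! ## §2. pp. 7–8: (1.24)×(1.25) per term and the level counts ⇒ (1.29) for the Y-sum as a function -/

/-- **(1.27) for the Y₀-sum AS THE PRINTED POWERSET SUM.**  p. 8 [PDF 8], verbatim: *"The sum over Y₀ is simply a sum
over subsets of the family of cubes Δ contained in □₀∖□̃⁴. The number of terms in this sum is an absolute number, but we
get a better bound using the last term under the exponential in (1.25). The sum is bounded by exp(8·12³ exp(−½(κ₁ −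
1))) ≤ e (1.27) for κ₁ sufficiently large."*  TYPED: Y₀ ↔ W ⊆ F (F = the cubes of □₀∖□̃⁴, #F ≤ 8·12³ as printed), the
last term of (1.25) is exp(−½(κ₁ − 1)N) with N = M⁻⁴|Y₀∖□̃⁴| ≥ #W; then Σ_W exp(−½(κ₁ − 1)N(W)) ≤ e once κ₁ ≥ 1 +
2 log(8·12³) (the explicit threshold of `B13Sect1Arith.bound_127`). [cite: Balaban1988RG2Cluster, (1.27) p.8] -/
theorem sumY0_127 {C : Type*} (F₀ : Finset C) (hF₀ : (F₀.card : ℝ) ≤ 8 * 12 ^ 3) (N : Finset C → ℝ)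
    (hN : ∀ W ∈ F₀.powerset, (W.card : ℝ) ≤ N W) {κ₁ : ℝ} (hκ₁ : 1 + 2 * Real.log (8 * 12 ^ 3) ≤ κ₁) :
    ∑ W ∈ F₀.powerset, Real.exp (-(1 / 2) * (κ₁ - 1) * N W) ≤ Real.exp 1 := by
  classical
  have hlog : 0 ≤ Real.log (8 * 12 ^ 3) := Real.log_nonneg (by norm_num)
  have hκ : 0 ≤ κ₁ - 1 := by linarith
  have hb := B13Sect1Arith.bound_127 F₀ hF₀ hκ₁
  refine le_trans (Finset.sum_le_sum fun W hW => ?_) (hb.1.trans hb.2)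
  have h1 : -(1 / 2) * (κ₁ - 1) * N W ≤ -(1 / 2) * (κ₁ - 1) * (W.card : ℝ) := by
    have := hN W hW
    nlinarith
  calc Real.exp (-(1 / 2) * (κ₁ - 1) * N W) ≤ Real.exp (-(1 / 2) * (κ₁ - 1) * (W.card : ℝ)) :=
        Real.exp_le_exp.mpr h1
    _ = Real.exp (-(1 / 2) * (κ₁ - 1)) ^ W.card := by
        rw [← Real.exp_nat_mul]; ring_nf

/-- **(1.24), (1.25), (1.26), (1.27), (1.28) ⇒ (1.29) for the Y-sum of the terms (1.23) AS A FUNCTION on the space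
(1.34).**  p. 7 [PDF 7] – p. 8 [PDF 8], verbatim: *"Now we consider the sum of all terms (1.23) having the same
localization domain Y. It is a sum over all admissible □₀, Y₀, j and X. The expression defined by this sum can be
bounded using (1.24), (1.25). At first we consider the sum over X. … For the second sum we have Σ_{X∈𝐃_j, X⊃□′}
exp(−κd_j(X)) ≤ O(1), (1.26) … To bound the first sum, over □′ ⊂ □̃², we use the factor (L^jη)⁵ in (1.24). This
yields (6L)⁴L^jη, and the sum over j is bounded by 2(6L)⁴. The sum over Y₀ … is bounded by … ≤ e (1.27) … Finally, the
sum over □₀ can be bounded by M⁻⁴|Y| ≤ 3·2³d_k(Y) ≤ exp(1/16)(κ₁ − 2)d_k(Y). (1.28)  Gathering together the above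
bounds we obtain |Σ(1.23)| ≤ E₀ε₁O(M^q) exp O(1)κ₁ exp(−(1/16)κ₁d_k(Y)), (1.29)"*.  TYPED over abstract finite index
sets exactly as the scalar certificate `B13Sect1Arith.gather_129` (□₀ ∈ `S0 Y`, Y₀ ∈ `SY Y □₀`, j ≤ k, □′ ∈ `Sq Y j`,
X ∈ `SX Y j □′`), for term FUNCTIONS `T Y □₀ Y₀ j □′ X : Φ → ℂ` whose norms on `S.sp1 Y` obey (1.24) with its first
exponential in the form (1.25) (`hT`), and the printed level bounds (`hX` = (1.26), `hq` = «(6L)⁴L^jη», `hj` =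
«2(6L)⁴», `hY` = (1.27), `h0` = the outer inequality of (1.28)): the function-level Y-sum is bounded on `S.sp1 Y` by
`K·O(1)·2(6L)⁴·e·exp(⅛κ₁d_k(□₀))·exp(−(1/16)κ₁d_k(Y))` — the shape (1.29) with every factor explicit.
[cite: Balaban1988RG2Cluster, (1.29) p.8] -/
theorem bound129_of_levels (S : B13.StepData) {α β γ δ : Type*} (S0 : S.Dk.Dom → Finset α)
    (SY : S.Dk.Dom → α → Finset β) (k : ℕ) (Sq : S.Dk.Dom → ℕ → Finset γ) (SX : S.Dk.Dom → ℕ → γ → Finset δ)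
    (T : (Y : S.Dk.Dom) → α → β → ℕ → γ → δ → S.Φ → ℂ) (ℓ : ℕ → ℝ) (dj : S.Dk.Dom → ℕ → γ → δ → ℝ)
    (n : S.Dk.Dom → α → β → ℝ) {K O1 L d0 κ κ₁ : ℝ} (hK : 0 ≤ K) (hO1 : 0 ≤ O1) (hℓ : ∀ j, 0 ≤ ℓ j)
    (hT : ∀ Y φ, φ ∈ S.sp1 Y → ∀ a ∈ S0 Y, ∀ y ∈ SY Y a, ∀ j ∈ Finset.range (k + 1), ∀ q ∈ Sq Y j,
      ∀ x ∈ SX Y j q, ‖T Y a y j q x φ‖ ≤ K * ℓ j ^ 5 * Real.exp (-(κ * dj Y j q x)) *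
        Real.exp (-(1 / 8) * (κ₁ - 1) * S.Dk.dj Y + (1 / 8) * κ₁ * d0 - (1 / 2) * (κ₁ - 1) * n Y a y))
    (hX : ∀ Y, ∀ j ∈ Finset.range (k + 1), ∀ q ∈ Sq Y j, ∑ x ∈ SX Y j q, Real.exp (-(κ * dj Y j q x)) ≤ O1)
    (hq : ∀ Y, ∀ j ∈ Finset.range (k + 1), ((Sq Y j).card : ℝ) * ℓ j ^ 5 ≤ (6 * L) ^ 4 * ℓ j)
    (hj : ∑ j ∈ Finset.range (k + 1), (6 * L) ^ 4 * ℓ j ≤ 2 * (6 * L) ^ 4)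
    (hY : ∀ Y, ∀ a ∈ S0 Y, ∑ y ∈ SY Y a, Real.exp (-(1 / 2) * (κ₁ - 1) * n Y a y) ≤ Real.exp 1)
    (h0 : ∀ Y, ((S0 Y).card : ℝ) ≤ Real.exp ((1 / 16) * (κ₁ - 2) * S.Dk.dj Y)) :
    ∀ Y φ, φ ∈ S.sp1 Y →
      ‖(∑ a ∈ S0 Y, ∑ y ∈ SY Y a, ∑ j ∈ Finset.range (k + 1), ∑ q ∈ Sq Y j, ∑ x ∈ SX Y j q,
          T Y a y j q x) φ‖
        ≤ K * O1 * (2 * (6 * L) ^ 4) * Real.exp 1 * Real.exp ((1 / 8) * κ₁ * d0) *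
          Real.exp (-(1 / 16) * κ₁ * S.Dk.dj Y) := by
  intro Y φ hφ
  have hgather := B13Sect1Arith.gather_129 (S0 Y) (SY Y) k (Sq Y) (SX Y)
    (fun a y j q x => ‖T Y a y j q x φ‖) ℓ (dj Y) (n Y) (L := L) (d := S.Dk.dj Y) (d0 := d0) hK hO1 hℓ
    (hT Y φ hφ) (hX Y) (hq Y) hj (hY Y) (h0 Y)
  refine le_trans ?_ hgather
  simp only [Finset.sum_apply]
  refine (norm_sum_le _ _).trans (Finset.sum_le_sum fun a _ => ?_)
  refine (norm_sum_le _ _).trans (Finset.sum_le_sum fun y _ => ?_)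
  refine (norm_sum_le _ _).trans (Finset.sum_le_sum fun j _ => ?_)
  refine (norm_sum_le _ _).trans (Finset.sum_le_sum fun q _ => ?_)
  exact norm_sum_le _ _

/-! ## §3. Lemma 1 end to end from the located inputs of pp. 7–9 -/

/-- **LEMMA 1 (1.33)–(1.36) p. 9 ASSEMBLED from the located printed inputs of pp. 7–9.**  The statement of record
`B13.Lemma1Printed S c` for step data `S` and constants `c`, GIVEN: (a) the decomposition of `V′_k(Y, ·)` into the
Y-sum of the terms (1.23) — over the admissible big cubes □₀ ⊂ Y (`S0 Y`), the domains Y₀ ↔ the subsets `W` of the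
cubes `F Y □₀` of □₀∖□̃⁴ (p. 8 *"simply a sum over subsets"*), the scales j ≤ k, the cubes □′ ⊂ □̃² of π_j (`Sq Y j`)
and the domains X ∈ 𝐃_j, X ⊃ □′ (`SX Y j □′`) — plus the Y-sum `W₂ Y` of the (I.3.7)-type terms (p. 2, p. 8, (1.33));
(b) p. 7 *"All terms (1.23) with the localization domain Y are defined and analytic on this space"* and p. 9 *"all
the terms are defined and analytic on it"* (`hAnT`, `hAn₂`), with the reader-owned `S.Analytic` closed under finite
sums ([folklore]: `hAdd`, `hZero`); (c) **(1.24)** p. 7 on the space (1.34): *"|(1.23)| ≤ 8B₀C₁e^{16κ₁}α₂⁻¹g_k|B|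
E₀(α₁/α₃)⁵(L^jη)⁵ exp(−(κ₁ − 1)M⁻⁴|Y₀∖□̃⁴|) exp(−κd_j(X))"* (`h124`; K = the prefactor with g_k|B| < ε₁, L^jη =
L^{j−k}, `N Y □₀ W` = M⁻⁴|Y₀∖□̃⁴| ≥ #W: `hN`) — by reference to (I.3.54), [15] Prop. 4, [13] (3.108), NOT re-derived;
(d) the geometric input of (1.25) d_k(Y) ≤ d_k(□₀) + 4M⁻⁴|Y₀∖□̃⁴| (`hG1`, cell census G1; `…TreeLength`) with d_k(□₀)
= `d0 ≥ 0`; (e) the printed counts: #F ≤ 8·12³ (`hF`), (1.26) (`h126`), «(6L)⁴L^jη» (`hq`), the outer inequality of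
(1.28) #{□₀} ≤ exp((1/16)(κ₁ − 2)d_k(Y)) (`h128`; cell GAPS G-B13-07 for its inner steps); (f) «κ₁ sufficiently large»
of (1.27) as κ₁ ≥ 1 + 2 log(8·12³), and L ≥ 2 ([I] p. 251: L odd > 11) for «bounded by 2(6L)⁴»; (g) p. 9: the
(I.3.7)-type Y-sum obeys the (1.29)-form bound with exp(−(1 − 2δ)κd_k(Y)) (`h129'`); (h) R9; (i) the choice of the
absolute constants C₁, C₂, q of (1.36) dominating the gathered prefactor K·O(1)·2(6L)⁴·e·e^{⅛κ₁d_k(□₀)} + P₂ (`hC`;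
print: *"E₀ε₁O(M^q) exp O(1)κ₁ … with absolute constants O(1), q"*, NOT asserted).  Kernel: (1.25) by
`B13Sect1Arith.bound_125`, (1.27) by `sumY0_127`, the j-sum by `B13Sect1Arith.jsum_le`, (1.29) by
`bound129_of_levels`, then `lemma1Printed_of_129`. [cite: Balaban1988RG2Cluster, Lemma 1 pp.7–9] -/
theorem lemma1Printed_of_sect1 (S : B13.StepData) (c : B13.Consts) {α γ δ C : Type*} (S0 : S.Dk.Dom → Finset α)
    (F : S.Dk.Dom → α → Finset C) (k : ℕ) (Sq : S.Dk.Dom → ℕ → Finset γ) (SX : S.Dk.Dom → ℕ → γ → Finset δ)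
    (T : (Y : S.Dk.Dom) → α → Finset C → ℕ → γ → δ → S.Φ → ℂ) (dj : S.Dk.Dom → ℕ → γ → δ → ℝ)
    (N : S.Dk.Dom → α → Finset C → ℝ) (W₂ : S.Dk.Dom → S.Φ → ℂ) {K O1 d0 P₂ : ℝ}
    (h133 : ∀ Y, S.Vp Y = (∑ a ∈ S0 Y, ∑ W ∈ (F Y a).powerset, ∑ j ∈ Finset.range (k + 1), ∑ q ∈ Sq Y j,
      ∑ x ∈ SX Y j q, T Y a W j q x) + W₂ Y)
    (hAdd : ∀ (s : Set S.Φ) (f g : S.Φ → ℂ), S.Analytic f s → S.Analytic g s → S.Analytic (f + g) s)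
    (hZero : ∀ s : Set S.Φ, S.Analytic 0 s)
    (hAnT : ∀ Y, ∀ a ∈ S0 Y, ∀ W ∈ (F Y a).powerset, ∀ j ∈ Finset.range (k + 1), ∀ q ∈ Sq Y j, ∀ x ∈ SX Y j q,
      S.Analytic (T Y a W j q x) (S.sp1 Y))
    (hAn₂ : ∀ Y, S.Analytic (W₂ Y) (S.sp1 Y))
    (hK : 0 ≤ K) (hO1 : 0 ≤ O1) (hd0 : 0 ≤ d0) (hL : 2 ≤ (c.L : ℝ))
    (hκ₁ : 1 + 2 * Real.log (8 * 12 ^ 3) ≤ c.κ₁)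
    (h124 : ∀ Y φ, φ ∈ S.sp1 Y → ∀ a ∈ S0 Y, ∀ W ∈ (F Y a).powerset, ∀ j ∈ Finset.range (k + 1), ∀ q ∈ Sq Y j,
      ∀ x ∈ SX Y j q, ‖T Y a W j q x φ‖ ≤ K * ((c.L : ℝ) ^ j * ((c.L : ℝ) ^ k)⁻¹) ^ 5 *
        Real.exp (-(c.κ₁ - 1) * N Y a W) * Real.exp (-(c.κ * dj Y j q x)))
    (hG1 : ∀ Y, ∀ a ∈ S0 Y, ∀ W ∈ (F Y a).powerset, S.Dk.dj Y ≤ d0 + 4 * N Y a W)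
    (hN : ∀ Y a, ∀ W ∈ (F Y a).powerset, (W.card : ℝ) ≤ N Y a W)
    (hF : ∀ Y a, ((F Y a).card : ℝ) ≤ 8 * 12 ^ 3)
    (h126 : ∀ Y, ∀ j ∈ Finset.range (k + 1), ∀ q ∈ Sq Y j,
      ∑ x ∈ SX Y j q, Real.exp (-(c.κ * dj Y j q x)) ≤ O1)
    (hq : ∀ Y, ∀ j ∈ Finset.range (k + 1),
      ((Sq Y j).card : ℝ) * ((c.L : ℝ) ^ j * ((c.L : ℝ) ^ k)⁻¹) ^ 5 ≤
        (6 * (c.L : ℝ)) ^ 4 * ((c.L : ℝ) ^ j * ((c.L : ℝ) ^ k)⁻¹))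
    (h128 : ∀ Y, ((S0 Y).card : ℝ) ≤ Real.exp ((1 / 16) * (c.κ₁ - 2) * S.Dk.dj Y))
    (h129' : ∀ Y φ, φ ∈ S.sp1 Y → ‖W₂ Y φ‖ ≤ P₂ * Real.exp (-(1 - 2 * c.δ) * c.κ * S.Dk.dj Y))
    (hR9 : (1 - 2 * c.δ) * c.κ ≤ (1 / 16) * c.κ₁)
    (hC : K * O1 * (2 * (6 * (c.L : ℝ)) ^ 4) * Real.exp 1 * Real.exp ((1 / 8) * c.κ₁ * d0) + P₂ ≤
      c.E₀ * c.ε₁ * c.C₁ * c.M ^ c.q * Real.exp (c.C₂ * c.κ₁)) :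
    B13.Lemma1Printed S c := by
  -- abbreviations: ℓ_j = L^jη = L^{j-k}
  set ℓ : ℕ → ℝ := fun j => (c.L : ℝ) ^ j * ((c.L : ℝ) ^ k)⁻¹ with hℓdef
  have hL0 : 0 < (c.L : ℝ) := by linarith
  have hℓ : ∀ j, 0 ≤ ℓ j := fun j => by positivity
  have hκ1 : 1 ≤ c.κ₁ := by
    have : 0 ≤ Real.log (8 * 12 ^ 3) := Real.log_nonneg (by norm_num)
    linarith
  -- (1.24) ⇒ the (1.25)-form per-term bound
  have hT : ∀ Y φ, φ ∈ S.sp1 Y → ∀ a ∈ S0 Y, ∀ W ∈ (F Y a).powerset, ∀ j ∈ Finset.range (k + 1), ∀ q ∈ Sq Y j,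
      ∀ x ∈ SX Y j q, ‖T Y a W j q x φ‖ ≤ K * ℓ j ^ 5 * Real.exp (-(c.κ * dj Y j q x)) *
        Real.exp (-(1 / 8) * (c.κ₁ - 1) * S.Dk.dj Y + (1 / 8) * c.κ₁ * d0 - (1 / 2) * (c.κ₁ - 1) * N Y a W) := by
    intro Y φ hφ a ha W hW j hj q hq' x hx
    have h := h124 Y φ hφ a ha W hW j hj q hq' x hx
    have h125 := B13Sect1Arith.bound_125 hκ1 hd0 (hG1 Y a ha W hW)
    calc ‖T Y a W j q x φ‖
        ≤ K * ℓ j ^ 5 * Real.exp (-(c.κ₁ - 1) * N Y a W) * Real.exp (-(c.κ * dj Y j q x)) := h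
      _ = K * ℓ j ^ 5 * Real.exp (-(c.κ * dj Y j q x)) * Real.exp (-(c.κ₁ - 1) * N Y a W) := by ring
      _ ≤ K * ℓ j ^ 5 * Real.exp (-(c.κ * dj Y j q x)) *
          Real.exp (-(1 / 8) * (c.κ₁ - 1) * S.Dk.dj Y + (1 / 8) * c.κ₁ * d0 - (1 / 2) * (c.κ₁ - 1) * N Y a W) :=
        mul_le_mul_of_nonneg_left h125 (by positivity)
  -- the j-sum «bounded by 2(6L)⁴» and (1.27)
  have hj : ∑ j ∈ Finset.range (k + 1), (6 * (c.L : ℝ)) ^ 4 * ℓ j ≤ 2 * (6 * (c.L : ℝ)) ^ 4 :=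
    B13Sect1Arith.jsum_le hL k
  have hY : ∀ Y, ∀ a ∈ S0 Y, ∑ W ∈ (F Y a).powerset, Real.exp (-(1 / 2) * (c.κ₁ - 1) * N Y a W) ≤ Real.exp 1 :=
    fun Y a _ => sumY0_127 (F Y a) (hF Y a) (N Y a) (hN Y a) hκ₁
  -- (1.29) for the function-level Y-sum
  have h129 := bound129_of_levels S S0 (fun Y a => (F Y a).powerset) k Sq SX T ℓ dj N (L := (c.L : ℝ))
    hK hO1 hℓ hT h126 hq hj hY h128
  -- analyticity of the Y-sum of the terms (1.23)
  have hAn₁ : ∀ Y, S.Analytic (∑ a ∈ S0 Y, ∑ W ∈ (F Y a).powerset, ∑ j ∈ Finset.range (k + 1), ∑ q ∈ Sq Y j,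
      ∑ x ∈ SX Y j q, T Y a W j q x) (S.sp1 Y) := by
    intro Y
    refine analytic_finset_sum S.Analytic (S.sp1 Y) (hAdd _) (hZero _) _ _ fun a ha => ?_
    refine analytic_finset_sum S.Analytic (S.sp1 Y) (hAdd _) (hZero _) _ _ fun W hW => ?_
    refine analytic_finset_sum S.Analytic (S.sp1 Y) (hAdd _) (hZero _) _ _ fun j hj' => ?_
    refine analytic_finset_sum S.Analytic (S.sp1 Y) (hAdd _) (hZero _) _ _ fun q hq' => ?_
    exact analytic_finset_sum S.Analytic (S.sp1 Y) (hAdd _) (hZero _) _ _ fun x hx => hAnT Y a ha W hW j hj' q hq' x hx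
  have hP₁ : 0 ≤ K * O1 * (2 * (6 * (c.L : ℝ)) ^ 4) * Real.exp 1 * Real.exp ((1 / 8) * c.κ₁ * d0) := by
    positivity
  exact lemma1Printed_of_129 S c _ W₂ hP₁ h133 hAdd hAn₁ hAn₂ h129 h129' hR9 hC

end Literature.MathematicalPhysics.QuantumFieldTheory.Balaban1983to89.B13Lemma1Assembly
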